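import Summits.HubbardSuperconductivity.HubbardSuperconductivity.Theses.AposterioriCapRg
import Literature.MathematicalPhysics.QuantumLattice.DWaveOrderParameterProofs
import Literature.MathematicalPhysics.QuantumLattice.FinDimSpectrumProofs

/-!
# Crux `FixedPointDWaveOrder` (stmt-HubbardSuperconductivity-1313) — ideator 1, round 1: first lemmas

Two crux-idea cards, both X-level (they use the freedoms of the TARGET that the cruxes below it do not have:
`∃ μ`, `∃ δ` in a window, and the fact that X is an order parameter DEFINED through a source):

* Card A `lro-first-kt-discharge`: discharge the source — grand-canonical torus LRO of `Δ_d` at `h = 0`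
  implies `HasDWaveOrder` (one-step Koma–Tasaki tower + the tree's linear-energy-gain criterion), so the
  engine may work at `h = 0` with manifest `U(1)`.
* Card B `generic-mu-concavity-closure`: joint concavity of the sourced ground-energy density in `(U, μ, h)`:
  density clause for a.e. `μ` (Griffiths), order parameter = `-∂ₕ⁺e`, upper semicontinuity in `(U, μ)`
  (closedness of order), and the transfer `OrderOnAEWindow → X`.

Everything is stated over existing declarations. PROVED here (0 sorries, axioms ⊆ {propext, Classical.choice,
Quot.sound}): the abstract one-step tower inequality `oneStepTower` (card A's load-bearing finite-volume step),
`ktDischarge_of_quant` (quantitative ⇒ qualitative discharge), the glue `fixedPoint_of_lroFirst`, the transfer `fixedPoint_of_orderOnAEWindow` (card B's first lemma, from `DensityAE`),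
`isClosed_orderFloor` and `order_of_dense_uniform` (from `OrderParameterUSC`). The `def … : Prop` items
(`KTDischarge`, `DensityAE`, `OrderParameterUSC`, …) are the lemmas of the lines, stated not claimed.
-/

noncomputable section
set_option linter.dupNamespace false

namespace Summit.HubbardSuperconductivity.HubbardSuperconductivity.Cruxes.FixedPointDWaveOrder.Ideator1

open Filter Set Topology MeasureTheory
open scoped InnerProductSpace Matrix ComplexOrder
open Literature.MathematicalPhysics.QuantumLattice Literature.Probability.LatticeModels
open Summit.HubbardSuperconductivity.HubbardSuperconductivity.Theses.AposterioriCapRg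

/-! ## §0 The shape of X -/

/-- The finite-volume grand-canonical tracial ground-state density at side `L+1`. -/
def gcDensity (U μ : ℝ) (L : ℕ) : ℝ :=
  ((hubbardTorusWith 2 (L + 1) 1 U μ).groundStateFunctional totalNumber).re / ((L + 1 : ℕ) : ℝ) ^ 2

/-- The density clause of X at `(U, δ, μ)`. -/
def DensityClause (U δ μ : ℝ) : Prop :=
  Tendsto (gcDensity U μ) atTop (𝓝 (1 - δ))

theorem fixedPointDWaveOrder_iff :
    FixedPointDWaveOrder ↔
      ∃ U ∈ Icc (2:ℝ) 3, ∃ δ ∈ Icc (1/5:ℝ) (7/20), ∃ μ : ℝ, DensityClause U δ μ ∧ HasDWaveOrder U μ :=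
  Iff.rfl

/-! ## §A Card `lro-first-kt-discharge` -/

/-- Grand-canonical, tracial, source-free torus LRO of the `d_{x²-y²}` pair field:
`0 < liminf_L (L+1)⁻⁴ Re ω₀^{GC}_{L+1}(Δ_d† Δ_d)`, `ω₀^{GC}` the tracial ground-state functional of
`H(1,U) - μN` on `(ℤ/(L+1)ℤ)²` (ALL sides, as in X). -/
def TorusGCDWaveLRO (U μ : ℝ) : Prop :=
  0 < liminf (fun L : ℕ =>
    ((hubbardTorusWith 2 (L + 1) 1 U μ).groundStateFunctional
        ((pairField dWaveFormFactor (L + 1))ᴴ * pairField dWaveFormFactor (L + 1))).re /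
      ((L + 1 : ℕ) : ℝ) ^ 4) atTop

/-- FIRST LEMMA of card A (Koma–Tasaki discharge of the source, `d`-wave/grand-canonical/tracial form):
torus LRO at `h = 0` forces a LINEAR sourced energy gain, hence a positive Koma–Tasaki order parameter.
Proof sketch: pick in the GC ground space an `N`-eigenvector `Φ_L` with `⟨Δ†Δ⟩ ≥` the tracial average;
the one-step tower state `Ξ = (Φ + Δ†Φ/‖Δ†Φ‖)/√2` has `Re⟨Ξ, Δ Ξ⟩ = ½‖Δ†Φ‖ ≥ ½σL²(1-o(1))` and energy
`≤ E₀ + ‖[H-μN, Δ†]Φ‖/(2‖Δ†Φ‖) = E₀ + O(1)`; feed `le_dWaveOrderParameter_of_le_liminf_energyGain`. -/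
def KTDischarge : Prop :=
  ∀ U μ : ℝ, TorusGCDWaveLRO U μ → HasDWaveOrder U μ

/-- Quantitative form: an eventual LRO floor `σ²` gives the order-parameter floor `σ/2`
(normalisation of `dWaveOrderParameter` = `Re ω(Δ)/L²`, source `-h(Δ+Δ†)`). -/
def KTDischargeQuant : Prop :=
  ∀ U μ σ : ℝ, 0 < σ →
    (∀ᶠ L : ℕ in atTop, σ ^ 2 ≤
      ((hubbardTorusWith 2 (L + 1) 1 U μ).groundStateFunctional
          ((pairField dWaveFormFactor (L + 1))ᴴ * pairField dWaveFormFactor (L + 1))).re /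
        ((L + 1 : ℕ) : ℝ) ^ 4) →
    σ / 2 ≤ dWaveOrderParameter U μ

/-- The quantitative form implies the qualitative one (positivity of `ω(ΔᴴΔ)` + filter bookkeeping). -/
theorem ktDischarge_of_quant (hq : KTDischargeQuant) : KTDischarge := by
  intro U μ hlro
  set f : ℕ → ℝ := fun L => ((hubbardTorusWith 2 (L + 1) 1 U μ).groundStateFunctional
        ((pairField dWaveFormFactor (L + 1))ᴴ * pairField dWaveFormFactor (L + 1))).re /
      ((L + 1 : ℕ) : ℝ) ^ 4 with hf
  have hf0 : ∀ L, 0 ≤ f L := fun L => by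
    apply div_nonneg
    · have := Matrix.groundStateFunctional_nonneg (hubbardTorusWith 2 (L + 1) 1 U μ)
        (pairField dWaveFormFactor (L + 1))
      exact (Complex.nonneg_iff.mp this).1
    · positivity
  have hl : 0 < liminf f atTop := hlro
  have hbdd : IsBoundedUnder (· ≥ ·) atTop f := isBoundedUnder_of ⟨0, fun L => hf0 L⟩
  have hev : ∀ᶠ L in atTop, liminf f atTop / 2 < f L :=
    eventually_lt_of_lt_liminf (by linarith) hbdd
  set σ : ℝ := Real.sqrt (liminf f atTop / 2) with hσdef
  have hσ : 0 < σ := Real.sqrt_pos.2 (by linarith)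
  have hσ2 : σ ^ 2 = liminf f atTop / 2 := Real.sq_sqrt (by linarith)
  have key := hq U μ σ hσ (hev.mono fun L hL => by rw [hσ2]; exact hL.le)
  exact (hasDWaveOrder_iff U μ).2 (lt_of_lt_of_le (by linarith) key)

/-- The abstract ONE-STEP TOWER inequality behind `KTDischarge` (finite-dimensional linear algebra;
`A` plays `Δ_d`, the three vanishing inner products are the charge-sector orthogonalities
`⟨Φ,Δ†Φ⟩ = ⟨Φ,Δ²Φ⟩ = ⟨Φ,Δ²Δ†Φ⟩ = 0` of an `N`-eigenvector). -/
theorem oneStepTower {E : Type*} [NormedAddCommGroup E] [InnerProductSpace ℂ E] [CompleteSpace E]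
    (H A : E →L[ℂ] E) (hH : IsSelfAdjoint H) (Φ : E) (hΦ : ‖Φ‖ = 1) (E₀ : ℝ)
    (heig : H Φ = (E₀ : ℂ) • Φ)
    (h1 : ⟪Φ, (ContinuousLinearMap.adjoint A) Φ⟫_ℂ = 0) (h2 : ⟪Φ, A (A Φ)⟫_ℂ = 0)
    (h3 : ⟪Φ, A (A (ContinuousLinearMap.adjoint A Φ))⟫_ℂ = 0)
    (hne : ContinuousLinearMap.adjoint A Φ ≠ 0) (h : ℝ) (_hh : 0 ≤ h) :
    ∃ v : E, ‖v‖ = 1 ∧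
      (⟪v, (H - (h : ℂ) • (A + ContinuousLinearMap.adjoint A)) v⟫_ℂ).re ≤
        E₀ + ‖(H * ContinuousLinearMap.adjoint A - ContinuousLinearMap.adjoint A * H) Φ‖ /
            (2 * ‖ContinuousLinearMap.adjoint A Φ‖) -
          h * ‖ContinuousLinearMap.adjoint A Φ‖ := by
  -- notation
  set B : E →L[ℂ] E := ContinuousLinearMap.adjoint A with hB
  set w : E := B Φ with hw
  set r : ℝ := ‖w‖ with hr
  have hr0 : 0 < r := norm_pos_iff.2 hne
  have hrne : (r : ℂ) ≠ 0 := by exact_mod_cast hr0.ne'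
  set X : E →L[ℂ] E := H * B - B * H with hX
  -- adjoint bookkeeping: ⟪B x, y⟫ = ⟪x, A y⟫ and ⟪x, B y⟫ = ⟪A x, y⟫
  have adjL : ∀ x y : E, ⟪B x, y⟫_ℂ = ⟪x, A y⟫_ℂ := fun x y =>
    ContinuousLinearMap.adjoint_inner_left A y x
  have adjR : ∀ x y : E, ⟪x, B y⟫_ℂ = ⟪A x, y⟫_ℂ := fun x y =>
    ContinuousLinearMap.adjoint_inner_right A x y
  -- H symmetric
  have hsym : ∀ x y : E, ⟪H x, y⟫_ℂ = ⟪x, H y⟫_ℂ := by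
    intro x y
    have := ContinuousLinearMap.adjoint_inner_left H y x
    rw [hH.adjoint_eq] at this
    exact this
  -- the elementary inner products
  have hww : ⟪w, w⟫_ℂ = ((r : ℝ) : ℂ) ^ 2 := by
    rw [hr]; exact inner_self_eq_norm_sq_to_K w
  have e_ΦΦ : ⟪Φ, H Φ⟫_ℂ = (E₀ : ℂ) := by
    rw [heig, inner_smul_right, inner_self_eq_norm_sq_to_K, hΦ]; simp
  have e_Φw : ⟪Φ, w⟫_ℂ = 0 := h1
  have e_wΦ : ⟪w, Φ⟫_ℂ = 0 := by rw [← inner_conj_symm, e_Φw]; simp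
  have e_ΦHw : ⟪Φ, H w⟫_ℂ = 0 := by
    rw [← hsym, heig, inner_smul_left, e_Φw]; simp
  have e_wHΦ : ⟪w, H Φ⟫_ℂ = 0 := by
    rw [heig, inner_smul_right, e_wΦ]; simp
  have e_wHw : ⟪w, H w⟫_ℂ = ⟪w, X Φ⟫_ℂ + (E₀ : ℂ) * ((r : ℝ) : ℂ) ^ 2 := by
    have : H w = X Φ + B (H Φ) := by
      simp only [hX, hw, ContinuousLinearMap.sub_apply, ContinuousLinearMap.mul_apply]; abel
    rw [this, inner_add_right, heig, map_smul, inner_smul_right, ← hw, hww]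
  -- source terms
  have s_ΦAΦ : ⟪Φ, A Φ⟫_ℂ = 0 := by
    rw [← adjL, ← hw, e_wΦ]
  have s_ΦBΦ : ⟪Φ, B Φ⟫_ℂ = 0 := e_Φw
  have s_ΦAw : ⟪Φ, A w⟫_ℂ = ((r : ℝ) : ℂ) ^ 2 := by
    rw [← adjL, ← hw, hww]
  have s_ΦBw : ⟪Φ, B w⟫_ℂ = 0 := by
    rw [adjR, hw, adjR, inner_eq_zero_symm.1]
    rw [← inner_conj_symm] at h2
    simpa using h2
  have s_wAΦ : ⟪w, A Φ⟫_ℂ = 0 := by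
    rw [hw, adjL]; exact h2
  have s_wBΦ : ⟪w, B Φ⟫_ℂ = ((r : ℝ) : ℂ) ^ 2 := by rw [← hw, hww]
  have s_wAw : ⟪w, A w⟫_ℂ = 0 := by
    rw [hw, adjL]; exact h3
  have s_wBw : ⟪w, B w⟫_ℂ = 0 := by
    rw [adjR, ← inner_conj_symm, s_wAw]; simp
  -- the trial vector u = Φ + r⁻¹ w, ‖u‖² = 2
  set Ψ : E := ((r : ℝ) : ℂ)⁻¹ • w with hΨ
  have nΨ : ‖Ψ‖ = 1 := by
    rw [hΨ, norm_smul, norm_inv, Complex.norm_real, Real.norm_eq_abs, abs_of_pos hr0, ← hr,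
      inv_mul_cancel₀ hr0.ne']
  have e_ΦΨ : ⟪Φ, Ψ⟫_ℂ = 0 := by rw [hΨ, inner_smul_right, e_Φw]; simp
  set u : E := Φ + Ψ with hu
  have nu : ‖u‖ ^ 2 = 2 := by
    rw [hu, @norm_add_sq ℂ, hΦ, nΨ, e_ΦΨ]; simp; norm_num
  have nu' : ‖u‖ = Real.sqrt 2 := by
    rw [← Real.sqrt_sq (norm_nonneg u), nu]
  -- expansion of ⟪u, T u⟫
  set T : E →L[ℂ] E := H - (h : ℂ) • (A + B) with hT
  have key : ⟪u, T u⟫_ℂ =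
      (E₀ : ℂ) + (((r : ℝ) : ℂ)⁻¹ * (starRingEnd ℂ) (((r : ℝ) : ℂ)⁻¹)) * (⟪w, X Φ⟫_ℂ + (E₀ : ℂ) * ((r : ℝ) : ℂ) ^ 2)
        - (h : ℂ) * (2 * ((r : ℝ) : ℂ)) := by
    have conj_r : (starRingEnd ℂ) (((r : ℝ) : ℂ)⁻¹) = ((r : ℝ) : ℂ)⁻¹ := by
      simp [Complex.conj_ofReal]
    simp only [hT, hu, hΨ, ContinuousLinearMap.sub_apply, ContinuousLinearMap.smul_apply,
      ContinuousLinearMap.add_apply, map_add, map_smul, inner_add_left, inner_add_right,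
      inner_sub_right, inner_smul_left, inner_smul_right, smul_add]
    rw [e_ΦΦ, e_ΦHw, e_wHΦ, e_wHw, s_ΦAΦ, s_ΦBΦ, s_ΦAw, s_ΦBw, s_wAΦ, s_wBΦ, s_wAw, s_wBw, conj_r]
    field_simp
    ring
  -- real part estimate
  have hre : (⟪u, T u⟫_ℂ).re ≤ 2 * E₀ + ‖X Φ‖ / r - h * (2 * r) := by
    rw [key]
    have conj_r : (starRingEnd ℂ) (((r : ℝ) : ℂ)⁻¹) = ((r : ℝ) : ℂ)⁻¹ := by
      simp [Complex.conj_ofReal]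
    rw [conj_r]
    have hcs : (⟪w, X Φ⟫_ℂ).re ≤ r * ‖X Φ‖ := by
      rw [hr]
      exact (Complex.re_le_norm _).trans (norm_inner_le_norm w (X Φ))
    have hrr : ((((r:ℝ):ℂ)⁻¹ * ((r:ℝ):ℂ)⁻¹) * (⟪w, X Φ⟫_ℂ + (E₀:ℂ) * ((r:ℝ):ℂ)^2)).re
        = r⁻¹ * r⁻¹ * ((⟪w, X Φ⟫_ℂ).re + E₀ * r ^ 2) := by
      have : (((r:ℝ):ℂ)⁻¹ * ((r:ℝ):ℂ)⁻¹) = (((r⁻¹ * r⁻¹ : ℝ)) : ℂ) := by push_cast; ring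
      rw [this, Complex.re_ofReal_mul]
      simp [Complex.add_re, Complex.mul_re, pow_two]
    simp only [Complex.sub_re, Complex.add_re, Complex.ofReal_re] at hrr ⊢
    rw [hrr]
    have h2r : ((h:ℂ) * (2 * ((r:ℝ):ℂ))).re = h * (2 * r) := by
      have : ((h:ℂ) * (2 * ((r:ℝ):ℂ))) = (((h * (2 * r) : ℝ)) : ℂ) := by push_cast; ring
      rw [this, Complex.ofReal_re]
    rw [h2r]
    have : r⁻¹ * r⁻¹ * ((⟪w, X Φ⟫_ℂ).re + E₀ * r ^ 2) ≤ r⁻¹ * r⁻¹ * (r * ‖X Φ‖ + E₀ * r ^ 2) := by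
      apply mul_le_mul_of_nonneg_left (by linarith) (by positivity)
    have hsimp : r⁻¹ * r⁻¹ * (r * ‖X Φ‖ + E₀ * r ^ 2) = ‖X Φ‖ / r + E₀ := by
      field_simp
    linarith
  -- normalise
  refine ⟨((Real.sqrt 2 : ℝ) : ℂ)⁻¹ • u, ?_, ?_⟩
  · rw [norm_smul, norm_inv, Complex.norm_real, Real.norm_eq_abs,
      abs_of_pos (Real.sqrt_pos.2 (by norm_num)), nu', inv_mul_cancel₀]
    exact (Real.sqrt_pos.2 (by norm_num)).ne'
  · have hsq : ((Real.sqrt 2 : ℝ) : ℂ)⁻¹ * (starRingEnd ℂ) (((Real.sqrt 2 : ℝ) : ℂ)⁻¹) = ((1/2 : ℝ) : ℂ) := by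
      rw [Complex.conj_inv, Complex.conj_ofReal, ← mul_inv, ← Complex.ofReal_mul,
        Real.mul_self_sqrt (by norm_num : (0:ℝ) ≤ 2)]
      push_cast; ring
    have : ⟪((Real.sqrt 2 : ℝ) : ℂ)⁻¹ • u, T (((Real.sqrt 2 : ℝ) : ℂ)⁻¹ • u)⟫_ℂ
        = ((1/2 : ℝ) : ℂ) * ⟪u, T u⟫_ℂ := by
      rw [map_smul, inner_smul_left, inner_smul_right, ← mul_assoc, mul_comm ((starRingEnd ℂ) _), hsq]
    rw [this, Complex.re_ofReal_mul]
    have hXr : ‖X Φ‖ / r = ‖X Φ‖ / (2 * r) * 2 := by field_simp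
    nlinarith [hre, hr0, norm_nonneg (X Φ)]

/-- Card A's transfer `C⁺`: X with the sourced order replaced by source-free GC torus LRO. -/
def LroFirst : Prop :=
  ∃ U ∈ Icc (2:ℝ) 3, ∃ δ ∈ Icc (1/5:ℝ) (7/20), ∃ μ : ℝ, DensityClause U δ μ ∧ TorusGCDWaveLRO U μ

/-- Glue of card A (pure logic, proved). -/
theorem fixedPoint_of_lroFirst (hKT : KTDischarge) (hL : LroFirst) : FixedPointDWaveOrder := by
  obtain ⟨U, hU, δ, hδ, μ, hd, hlro⟩ := hL
  exact ⟨U, hU, δ, hδ, μ, hd, hKT U μ hlro⟩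

/-! ## §B Card `generic-mu-concavity-closure` -/

/-- Finite-volume sourced GC ground-energy density `e_{L+1}(U, μ, h)`. -/
def eFin (U μ h : ℝ) (L : ℕ) : ℝ :=
  (dWaveSourceTorus (L + 1) U μ h).groundEnergy / ((L + 1 : ℕ) : ℝ) ^ 2

/-- Its thermodynamic limit (junk if the limit does not exist; `SourcedEnergyDensityLimit` says it does). -/
def eInf (U μ h : ℝ) : ℝ := limUnder atTop (eFin U μ h)

/-- (S1) the thermodynamic limit of the sourced GC ground-energy density exists along ALL sides. -/
def SourcedEnergyDensityLimit : Prop :=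
  ∀ U μ h : ℝ, Tendsto (eFin U μ h) atTop (𝓝 (eInf U μ h))

/-- (S2) joint concavity in `(U, μ, h)` (each finite-volume `e_L` is an infimum of affine functions). -/
def JointConcavity : Prop :=
  ConcaveOn ℝ Set.univ (fun p : ℝ × ℝ × ℝ => eInf p.1 p.2.1 p.2.2)

/-- (S3) identification: the Koma–Tasaki order parameter IS the right `h`-derivative of `-e/2` at `h = 0`
(the `liminf`s in `dWaveOrderParameter` are limits; chord inequalities of the tree + (S1)). -/
def OrderParameterIsDerivative : Prop :=
  ∀ U μ : ℝ, Tendsto (fun h : ℝ => (eInf U μ 0 - eInf U μ h) / (2 * h)) (𝓝[>] 0)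
    (𝓝 (dWaveOrderParameter U μ))

/-- (S4) upper semicontinuity of the order parameter in `(U, μ)`: an infimum over `h > 0` of the continuous
functions `(U, μ) ↦ (e(U,μ,0) - e(U,μ,h))/(2h)` (concave ⇒ continuous at fixed `h`). -/
def OrderParameterUSC : Prop :=
  UpperSemicontinuous (fun p : ℝ × ℝ => dWaveOrderParameter p.1 p.2)

/-- Closedness of order (corollary of (S4), proved from it): limits of parameter points with a UNIFORM
order floor keep the floor. -/
theorem isClosed_orderFloor (husc : OrderParameterUSC) (c : ℝ) :
    IsClosed {p : ℝ × ℝ | c ≤ dWaveOrderParameter p.1 p.2} := by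
  have := (upperSemicontinuous_iff_isClosed_preimage.1 husc) c
  simpa [Set.preimage, Set.Ici] using this

/-- (S5) density clause for a.e. `μ` (Griffiths' lemma for the concave `μ ↦ e(U, μ, 0)`; `n = -∂_μ e`,
non-decreasing): -/
def DensityAE : Prop :=
  ∀ U : ℝ, ∃ n : ℝ → ℝ, Monotone n ∧ ∀ᵐ μ : ℝ, Tendsto (gcDensity U μ) atTop (𝓝 (n μ))

/-- Card B's transfer `C⁺`: order for a.e. `μ` in a window whose limiting densities lie in `[13/20, 4/5]`
(no exact density to hit, no non-generic `μ` to handle). -/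
def OrderOnAEWindow : Prop :=
  ∃ U ∈ Icc (2:ℝ) 3, ∃ a b : ℝ, a < b ∧
    (∀ᵐ μ : ℝ, μ ∈ Ioo a b → HasDWaveOrder U μ) ∧
    (∀ μ ∈ Ioo a b, ∀ x : ℝ, MapClusterPt x atTop (gcDensity U μ) → x ∈ Icc (13/20 : ℝ) (4/5))

/-- FIRST LEMMA of card B: the transfer (measure theory + (S5)). -/
theorem fixedPoint_of_orderOnAEWindow (hD : DensityAE) (hW : OrderOnAEWindow) :
    FixedPointDWaveOrder := by
  obtain ⟨U, hU, a, b, hab, hord, hwin⟩ := hW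
  obtain ⟨n, _hmono, hn⟩ := hD U
  -- a.e. μ ∈ (a,b) has both convergence of densities and order; (a,b) has positive measure
  have hboth : ∀ᵐ μ : ℝ, μ ∈ Ioo a b → (HasDWaveOrder U μ ∧ Tendsto (gcDensity U μ) atTop (𝓝 (n μ))) := by
    filter_upwards [hord, hn] with μ h1 h2 hμ using ⟨h1 hμ, h2⟩
  have hres : ∀ᵐ μ ∂(volume.restrict (Ioo a b)),
      μ ∈ Ioo a b ∧ (HasDWaveOrder U μ ∧ Tendsto (gcDensity U μ) atTop (𝓝 (n μ))) := by
    have hmem : ∀ᵐ μ ∂(volume.restrict (Ioo a b)), μ ∈ Ioo a b :=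
      ae_restrict_mem measurableSet_Ioo
    filter_upwards [hmem, ae_restrict_of_ae (s := Ioo a b) hboth] with μ hμ h using ⟨hμ, h hμ⟩
  have hne : volume.restrict (Ioo a b) ≠ 0 := by
    intro h0
    have : volume (Ioo a b) = 0 := by
      have := congrArg (fun m => m (Ioo a b)) h0
      simpa [Measure.restrict_apply measurableSet_Ioo] using this
    rw [Real.volume_Ioo] at this
    have : ENNReal.ofReal (b - a) ≠ 0 := by
      simpa [ENNReal.ofReal_eq_zero, not_le] using sub_pos.2 hab
    contradiction
  haveI : (ae (volume.restrict (Ioo a b))).NeBot := ae_neBot.2 hne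
  obtain ⟨μ, hμ, hordμ, hdens⟩ := hres.exists
  have hx : n μ ∈ Icc (13/20 : ℝ) (4/5) := hwin μ hμ (n μ) hdens.mapClusterPt
  refine ⟨U, hU, 1 - n μ, ⟨by linarith [hx.2], by linarith [hx.1]⟩, μ, ?_, hordμ⟩
  show Tendsto (gcDensity U μ) atTop (𝓝 (1 - (1 - n μ)))
  simpa using hdens

/-- Variant via closedness: order on a DENSE subset of a window with a UNIFORM floor extends to the whole
window (from (S4)). -/
theorem order_of_dense_uniform (husc : OrderParameterUSC) {U a b c : ℝ} (hc : 0 < c)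
    {D : Set ℝ} (hD : Dense D)
    (hfloor : ∀ μ ∈ D ∩ Ioo a b, c ≤ dWaveOrderParameter U μ) :
    ∀ μ ∈ Ioo a b, HasDWaveOrder U μ := by
  intro μ hμ
  set S : Set (ℝ × ℝ) := {p | c ≤ dWaveOrderParameter p.1 p.2} with hS
  have hcl : IsClosed S := isClosed_orderFloor husc c
  have hf : Continuous (fun ν : ℝ => ((U, ν) : ℝ × ℝ)) := by fun_prop
  have h1 : μ ∈ closure (Ioo a b ∩ D) := hD.open_subset_closure_inter isOpen_Ioo hμ
  have h2 : ((U, μ) : ℝ × ℝ) ∈ closure ((fun ν : ℝ => ((U, ν) : ℝ × ℝ)) '' (Ioo a b ∩ D)) :=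
    image_closure_subset_closure_image hf ⟨μ, h1, rfl⟩
  have h3 : (fun ν : ℝ => ((U, ν) : ℝ × ℝ)) '' (Ioo a b ∩ D) ⊆ S := by
    rintro _ ⟨ν, hν, rfl⟩
    exact hfloor ν ⟨hν.2, hν.1⟩
  have h4 : ((U, μ) : ℝ × ℝ) ∈ S := by
    have := closure_mono h3 h2
    rwa [hcl.closure_eq] at this
  exact (hasDWaveOrder_iff U μ).2 (lt_of_lt_of_le hc h4)

end Summit.HubbardSuperconductivity.HubbardSuperconductivity.Cruxes.FixedPointDWaveOrder.Ideator1
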